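import Literature.Computability.AlgebraicComplexity.KoszulFlatteningKronecker
import HarnessLib

/-!
# The fullness index is multiplicative under tensor products (Alman–Li 2026, §5.3, Prop. 5.6)

Topic `Literature/Computability/AlgebraicComplexity` (family `MatrixMultiplication`). Source: J. Alman,
B. Li, *Asymptotic Rank Speedup Theorems, Revisited*, arXiv:2605.21738 (2026), §5.3 (held text
`paper:arxiv-2605.21738`, p0014 L22–38).

## The printed text (p0014)

"Given a degeneration `T ⊕ ⟨1,t,1⟩ ⊴ S`, let `f : W → 𝔽(λ)` be the component of the `C`-map
projecting to the slice `⟨1,t,1⟩`. We define the fullness index of `⟨1,t,1⟩` (or `f`) as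
`q = Rk((id_U ⊗ id_V ⊗ f) S)`. If `q = dim U = dim V`, we say the slice is full. […]
**Proposition 5.6.** Consider two degenerations `T₁ ⊕ ⟨1,t₁,1⟩ ⊴ S₁`, `T₂ ⊕ ⟨1,t₂,1⟩ ⊴ S₂`, wherein
the summands `⟨1,t₁,1⟩` and `⟨1,t₂,1⟩` have fullness indices `q₁` and `q₂`, respectively. Then the
direct summand `⟨1, t₁t₂, 1⟩` in the tensor product of these two degenerations has fullness index
`q₁q₂`. In particular, if `f₁` and `f₂` are full, then `f₁ ⊗ f₂` is full."

## The form proved here (coordinates)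

The fullness index of a functional `f : μ → K` against `S : ι → κ → μ → K` is the rank of the
contraction `M_f(S) = (id ⊗ id ⊗ f) S`, `(M_f)_{ab} = ∑_c f_c S_{abc}` (the matrix that appears in
`AlmanLi2026OneSliceRankCount.lean` / Prop. 5.3).  In the tensor product of the two degenerations
the `C`-component projecting to `⟨1,t₁,1⟩ ⊗ ⟨1,t₂,1⟩ = ⟨1,t₁t₂,1⟩` is `f₁ ⊗ f₂`, and the content
of Prop. 5.6 is the identity `M_{f₁⊗f₂}(S₁ ⊠ S₂) = M_{f₁}(S₁) ⊗ M_{f₂}(S₂)` (Kronecker product)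
together with the multiplicativity of matrix rank under Kronecker products (tree:
`matRank_kroneckerMap_mul`):

* `AlmanLi2026.contraction_kroneckerTensor` — the Kronecker identity (every commutative semiring);
* `AlmanLi2026.prop56` — `rank M_{f₁⊗f₂}(S₁ ⊠ S₂) = rank M_{f₁}(S₁) · rank M_{f₂}(S₂)`;
* `AlmanLi2026.prop56_full` — "if `f₁` and `f₂` are full, then `f₁ ⊗ f₂` is full".

No new definitions (the fullness index is written as the rank of the explicit matrix), no named
facts.

## References

* J. Alman, B. Li, *Asymptotic Rank Speedup Theorems, Revisited*, arXiv:2605.21738 (2026), §5.3,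
  Prop. 5.6 (p0014). [AlmanLi2026]
-/

noncomputable section

open scoped BigOperators

namespace Literature.Computability.AlgebraicComplexity

universe u

variable {K : Type u}
variable {ι₁ κ₁ μ₁ ι₂ κ₂ μ₂ : Type*}

namespace AlmanLi2026

/-- `(id ⊗ id ⊗ (f₁ ⊗ f₂))(S₁ ⊠ S₂) = (id ⊗ id ⊗ f₁) S₁ ⊗ (id ⊗ id ⊗ f₂) S₂` (Kronecker product of
the two contractions). [cite: AlmanLi2026, Prop. 5.6 (proof: tensor product of the degenerations)] -/
theorem contraction_kroneckerTensor [CommSemiring K] [Fintype μ₁] [Fintype μ₂]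
    (S₁ : ι₁ → κ₁ → μ₁ → K) (S₂ : ι₂ → κ₂ → μ₂ → K) (f₁ : μ₁ → K) (f₂ : μ₂ → K) :
    (Matrix.of fun (a : ι₁ × ι₂) (b : κ₁ × κ₂) =>
        ∑ c : μ₁ × μ₂, f₁ c.1 * f₂ c.2 * kroneckerTensor S₁ S₂ a b c) =
      Matrix.kroneckerMap (· * ·) (Matrix.of fun a b => ∑ c, f₁ c * S₁ a b c)
        (Matrix.of fun a b => ∑ c, f₂ c * S₂ a b c) := by
  ext a b
  simp only [Matrix.of_apply, Matrix.kroneckerMap_apply, kroneckerTensor_apply,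
    Fintype.sum_prod_type, Finset.sum_mul_sum]
  refine Finset.sum_congr rfl fun c₁ _ => Finset.sum_congr rfl fun c₂ _ => ?_
  ring

/-- **Alman–Li 2026, Prop. 5.6**: the fullness index is multiplicative — for functionals `f₁`, `f₂`
with fullness indices `q₁ = rank (id ⊗ id ⊗ f₁) S₁`, `q₂ = rank (id ⊗ id ⊗ f₂) S₂`, the functional
`f₁ ⊗ f₂` on the third mode of `S₁ ⊠ S₂` has fullness index `q₁ q₂`.
[cite: AlmanLi2026, Prop. 5.6] -/
theorem prop56 [Field K] [Fintype ι₁] [Fintype κ₁] [Fintype μ₁] [Fintype ι₂] [Fintype κ₂]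
    [Fintype μ₂] [DecidableEq κ₁] [DecidableEq κ₂] (S₁ : ι₁ → κ₁ → μ₁ → K)
    (S₂ : ι₂ → κ₂ → μ₂ → K) (f₁ : μ₁ → K) (f₂ : μ₂ → K) :
    (Matrix.of fun (a : ι₁ × ι₂) (b : κ₁ × κ₂) =>
        ∑ c : μ₁ × μ₂, f₁ c.1 * f₂ c.2 * kroneckerTensor S₁ S₂ a b c).rank =
      (Matrix.of fun a b => ∑ c, f₁ c * S₁ a b c).rank *
        (Matrix.of fun a b => ∑ c, f₂ c * S₂ a b c).rank := by
  rw [contraction_kroneckerTensor, matRank_kroneckerMap_mul]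

/-- **Alman–Li 2026, Prop. 5.6, "in particular"**: if `f₁` and `f₂` are full
(`qᵢ = dim Uᵢ = dim Vᵢ`), then `f₁ ⊗ f₂` is full. [cite: AlmanLi2026, Prop. 5.6] -/
theorem prop56_full [Field K] [Fintype ι₁] [Fintype κ₁] [Fintype μ₁] [Fintype ι₂] [Fintype κ₂]
    [Fintype μ₂] [DecidableEq κ₁] [DecidableEq κ₂] (S₁ : ι₁ → κ₁ → μ₁ → K)
    (S₂ : ι₂ → κ₂ → μ₂ → K) (f₁ : μ₁ → K) (f₂ : μ₂ → K)
    (h₁ : (Matrix.of fun a b => ∑ c, f₁ c * S₁ a b c).rank = Fintype.card ι₁)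
    (h₁' : Fintype.card ι₁ = Fintype.card κ₁)
    (h₂ : (Matrix.of fun a b => ∑ c, f₂ c * S₂ a b c).rank = Fintype.card ι₂)
    (h₂' : Fintype.card ι₂ = Fintype.card κ₂) :
    (Matrix.of fun (a : ι₁ × ι₂) (b : κ₁ × κ₂) =>
        ∑ c : μ₁ × μ₂, f₁ c.1 * f₂ c.2 * kroneckerTensor S₁ S₂ a b c).rank =
      Fintype.card (ι₁ × ι₂) ∧ Fintype.card (ι₁ × ι₂) = Fintype.card (κ₁ × κ₂) := by
  rw [prop56, h₁, h₂, Fintype.card_prod, Fintype.card_prod, h₁', h₂']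
  exact ⟨rfl, rfl⟩

end AlmanLi2026

end Literature.Computability.AlgebraicComplexity
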